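import Literature.AlgebraicGeometry.Resolution.Alterations
import Literature.AlgebraicGeometry.Motives.Varieties
import Mathlib.AlgebraicGeometry.Morphisms.QuasiFinite
import Mathlib.AlgebraicGeometry.FunctionField
import HarnessLib

/-!
# De Jong's alteration theorem — proof architecture, first rungs

Topic: `Literature/AlgebraicGeometry/Resolution`. Companion to `Alterations.lean`, working
towards `theorem DeJong1996_holds : DeJong1996` (de Jong 1996, Thm. 4.1). The printed proof
(loc. cit. 4.3–4.28 with §§2, 3, 5) is an induction on `dim X` for the STRONG statement
(projective regular compactification `X̄₁` with strict normal crossings boundary), through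
Chow's lemma, blowing up, Lefschetz pencils (Lemma 4.11), Stein factorisation, the multisection
Lemma 4.13, the projective moduli scheme of stable pointed curves with level structure over
`ℤ[1/ℓ]` (2.24), flattening by blow-up (2.19), the three-point Lemma 4.20–4.21, and the explicit
resolution of semi-stable families over a normal crossings base (Lemma 3.2, 3.5, 4.25–4.28). None
of these inputs is in Mathlib (v4.32); this file lands the rungs that are statable and provable
now and vendors the intermediate printed statement that the weak form follows from.

## Content

* `genericPoint_eq_of_isDominant` — a dominant morphism of integral schemes sends the generic
  point to the generic point.
* `eq_genericPoint_of_isFinite_restrict` — if `φ` is finite over an open `U`, the only point of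
  `φ⁻¹(U)` above the generic point `η_X` is the generic point of the source
  (finite ⟹ discrete fibres, Mathlib `Scheme.Hom.isDiscrete_preimage_singleton`).
* `isFinite_morphismRestrict_of_le` — finiteness over `V` restricts to any open `U ≤ V`.
* `IsAlteration.surjective`, `IsAlteration.comp` — de Jong 1996, 2.20: "A composition of
  alterations is an alteration" (used at every reduction step 4.4–4.22 of the printed proof).
* `Scheme.IsRegular.of_isOpenImmersion` — an open subscheme of a regular scheme is regular.
* `DeJong1996Projective` — NAMED FACT, Thm. 4.1 with conclusion (i) in full: the alteration `X₁`
  is an open subscheme of a regular projective variety `X̄₁` over `k` (conclusion (ii), the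
  strict normal crossings boundary, needs a notion Mathlib lacks and is deferred).
  `DeJong1996Projective.deJong1996 : DeJong1996Projective → DeJong1996` is proved.
* `deJong1996_of_topologicalKrullDim_le_zero` — the base case `dim X = 0` of the induction
  (4.3), proved: an integral scheme of dimension `0` is a single point whose local ring is its
  function field, hence regular, and the identity is an alteration.
* `deJong1996_of_isAlteration` — the reduction step 4.4 for the weak form, proved (a regular
  alteration of an alteration of `X` is a regular alteration of `X`).

## Sources

* A. J. de Jong, *Smoothness, semi-stability and alterations*, Publ. Math. IHÉS 83 (1996) 51–93:
  2.20 (alterations, composition), Thm. 4.1, 4.3 (induction on `dim X`, case `dim X = 0`).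
* The Stacks Project, Tag 02IS (regular schemes), Tag 0CC1 (dominant morphisms and generic
  points), Tag 02NH (finite morphisms have discrete fibres).
-/

noncomputable section

open CategoryTheory AlgebraicGeometry TopologicalSpace Topology

namespace Literature.AlgebraicGeometry.Resolution

universe u

/-! ## Generic points under dominant and generically finite morphisms -/

/-- A dominant morphism between integral schemes maps the generic point of the source to the
generic point of the target (Stacks, Tag 0CC1). [folklore] -/
theorem genericPoint_eq_of_isDominant {X' X : Scheme.{u}} (φ : X' ⟶ X) [IsIntegral X']
    [IsIntegral X] [IsDominant φ] : φ (genericPoint X') = genericPoint X := by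
  have h : IsGenericPoint (φ (genericPoint X')) (closure (φ '' Set.univ)) :=
    (genericPoint_spec X').image φ.continuous
  rw [Set.image_univ, φ.denseRange.closure_range] at h
  exact h.eq (genericPoint_spec X)

/-- A point mapping to the generic point of an integral scheme is mapped there together with the
generic point of the (integral) source. [folklore] -/
theorem genericPoint_map_eq_of_map_eq {X' X : Scheme.{u}} (φ : X' ⟶ X) [IsIntegral X']
    [IsIntegral X] {x' : X'} (hx' : φ x' = genericPoint X) :
    φ (genericPoint X') = genericPoint X := by
  have hspec : φ (genericPoint X') ⤳ genericPoint X :=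
    hx' ▸ (genericPoint_specializes x').map φ.continuous
  refine IsGenericPoint.eq ?_ (genericPoint_spec X)
  rw [isGenericPoint_def, ← Set.univ_subset_iff, ← genericPoint_closure X]
  exact closure_minimal
    (Set.singleton_subset_iff.mpr (specializes_iff_mem_closure.mp hspec)) isClosed_closure

/-- If `φ : X' ⟶ X` (integral schemes) is finite over an open `U ⊆ X`, then a point of `φ⁻¹(U)`
lying over the generic point of `X` is the generic point of `X'`: the fibre is discrete
(Stacks, Tag 02NH) and the generic point of `X'` specialises to every point. [folklore] -/
theorem eq_genericPoint_of_isFinite_restrict {X' X : Scheme.{u}} (φ : X' ⟶ X) [IsIntegral X']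
    [IsIntegral X] (U : X.Opens) [IsFinite (φ ∣_ U)] {x' : X'} (hx'U : x' ∈ φ ⁻¹ᵁ U)
    (hx' : φ x' = genericPoint X) : x' = genericPoint X' := by
  have hφξ : φ (genericPoint X') = genericPoint X := genericPoint_map_eq_of_map_eq φ hx'
  have hηU : genericPoint X ∈ U := by simpa [hx'] using hx'U
  have hξU : genericPoint X' ∈ φ ⁻¹ᵁ U := by
    show φ (genericPoint X') ∈ U
    rwa [hφξ]
  have hdisc := (φ ∣_ U).isDiscrete_preimage_singleton ⟨genericPoint X, hηU⟩
  have hmem : ∀ (z : ↥(φ ⁻¹ᵁ U)), φ z.1 = genericPoint X →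
      z ∈ (φ ∣_ U) ⁻¹' {(⟨genericPoint X, hηU⟩ : ↥U)} := by
    intro z hz
    apply Subtype.ext
    rw [morphismRestrict_base_coe]
    exact hz
  have hspec : (⟨genericPoint X', hξU⟩ : ↥(φ ⁻¹ᵁ U)) ⤳ ⟨x', hx'U⟩ :=
    ((φ ⁻¹ᵁ U).ι.isOpenEmbedding.isInducing.specializes_iff).mp (genericPoint_specializes x')
  have := hdisc.eq_of_specializes hspec (hmem _ hφξ) (hmem _ hx')
  exact (congrArg Subtype.val this).symm

/-- Finiteness over an open `V` of the target passes to every smaller open `U ≤ V`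
(base change of `φ ∣_ V` along the open immersion `U ↪ V`). [folklore] -/
theorem isFinite_morphismRestrict_of_le {X Y : Scheme.{u}} (f : X ⟶ Y) {U V : Y.Opens}
    (e : U ≤ V) [IsFinite (f ∣_ V)] : IsFinite (f ∣_ U) := by
  have sq : IsPullback (X.homOfLE (f.preimage_mono e)) (f ∣_ U) (f ∣_ V) (Y.homOfLE e) := by
    refine IsPullback.of_right (h₁₂ := (f ⁻¹ᵁ V).ι) (h₂₂ := V.ι) ?_
      (morphismRestrict_homOfLE f U V e).symm (isPullback_morphismRestrict f V).flip
    simpa only [Scheme.homOfLE_ι] using (isPullback_morphismRestrict f U).flip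
  exact MorphismProperty.of_isPullback sq ‹_›

/-! ## Alterations: surjectivity and composition (de Jong 1996, 2.20) -/

/-- An alteration is surjective: it is dominant and (being proper) closed. [folklore] -/
theorem IsAlteration.surjective {X' X : Scheme.{u}} {φ : X' ⟶ X} (h : IsAlteration φ) :
    Surjective φ := by
  haveI := h.isProper
  haveI := h.isDominant
  exact surjective_of_isDominant_of_isClosed_range φ (φ.isClosedMap.isClosed_range)

/-- **Composition of alterations** (de Jong 1996, 2.20: "A composition of alterations is an
alteration"). If `ψ : X'' → X'` and `φ : X' → X` are alterations (with `X` integral) then so is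
`ψ ≫ φ`; the open of finiteness is `U ∖ φ(X' ∖ V)` where `φ` is finite over `U` and `ψ` over `V`
— it contains the generic point of `X` because the only point of `φ⁻¹(U)` over it is the generic
point of `X'`, which lies in `V`. [cite: DeJong1996, 2.20] -/
theorem IsAlteration.comp {X'' X' X : Scheme.{u}} {ψ : X'' ⟶ X'} {φ : X' ⟶ X} [IsIntegral X]
    (hψ : IsAlteration ψ) (hφ : IsAlteration φ) : IsAlteration (ψ ≫ φ) := by
  haveI := hψ.isIntegral
  haveI := hφ.isIntegral
  haveI := hψ.isProper
  haveI := hφ.isProper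
  haveI := hψ.isDominant
  haveI := hφ.isDominant
  refine ⟨inferInstance, inferInstance, inferInstance, ?_⟩
  obtain ⟨U, hU, hUfin⟩ := hφ.exists_isFinite
  obtain ⟨V, hV, hVfin⟩ := hψ.exists_isFinite
  -- the closed set of `X` over which `φ⁻¹` leaves `V`
  have hC : IsClosed (φ '' (V : Set X')ᶜ) := φ.isClosedMap _ V.isOpen.isClosed_compl
  let W : X.Opens := ⟨(U : Set X) \ φ '' (V : Set X')ᶜ, U.isOpen.sdiff hC⟩
  have hWU : W ≤ U := fun _ hx => hx.1
  have hWV : φ ⁻¹ᵁ W ≤ V := by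
    intro x hx
    by_contra hxV
    exact hx.2 ⟨x, hxV, rfl⟩
  refine ⟨W, ?_, ?_⟩
  · -- the generic point of `X` lies in `W`
    refine ⟨genericPoint X, ?_, ?_⟩
    · exact ((genericPoint_spec X).mem_open_set_iff U.isOpen).mpr (by simpa using hU)
    · rintro ⟨x', hx'V, hx'⟩
      haveI := hUfin
      have hx'U : x' ∈ φ ⁻¹ᵁ U := by
        show φ x' ∈ U
        rw [hx']
        exact ((genericPoint_spec X).mem_open_set_iff U.isOpen).mpr (by simpa using hU)
      have := eq_genericPoint_of_isFinite_restrict φ U hx'U hx'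
      apply hx'V
      rw [this]
      exact ((genericPoint_spec X').mem_open_set_iff V.isOpen).mpr (by simpa using hV)
  · rw [morphismRestrict_comp]
    exact MorphismProperty.comp_mem _ _ _ (isFinite_morphismRestrict_of_le ψ hWV)
      (isFinite_morphismRestrict_of_le φ hWU)

/-! ## Regularity of open subschemes -/

/-- An open subscheme of a regular scheme is regular: open immersions induce isomorphisms on
local rings (Stacks, Tag 02IS with 01HZ). [folklore] -/
theorem Scheme.IsRegular.of_isOpenImmersion {U X : Scheme.{u}} (j : U ⟶ X) [IsOpenImmersion j]
    (h : Scheme.IsRegular X) : Scheme.IsRegular U := by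
  intro x
  haveI := h (j x)
  exact IsRegularLocalRing.of_ringEquiv (asIso (j.stalkMap x)).commRingCatIsoToRingEquiv

/-! ## Theorem 4.1 (i): projective regular compactification of the alteration -/

/-- NAMED FACT — **de Jong's alteration theorem, projective form** (de Jong 1996, Thm. 4.1,
conclusion (i); with 2.9 and 2.20): "Let `X` be a variety over a field `k` [integral separated
`k`-scheme of finite type] and `Z ⊂ X` a proper closed subset. There exist an alteration
`φ₁ : X₁ → X` and an open immersion `j₁ : X₁ → X̄₁` such that (i) `X̄₁` is a projective variety
and is a regular scheme, and (ii) `j₁(φ₁⁻¹ Z) ∪ (X̄₁ ∖ j₁ X₁)` is a strict normal crossings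
divisor in `X̄₁`." Vendored with conclusion (i) in full and everything over `k`
(`j₁ ≫ (X̄₁ → Spec k) = φ₁ ≫ (X → Spec k)`); conclusion (ii) and the generically-étale
refinement for perfect `k` are not rendered (no strict-normal-crossings notion in Mathlib yet).
"Projective variety over `k`" = integral `k`-scheme admitting a closed `k`-immersion into some
`ℙⁿ_k` (`Literature.AlgebraicGeometry.Motives.IsProjectiveOver`). Users take `(h : DeJong1996Projective)`.
[cite: DeJong1996, Thm. 4.1 (i)] -/
def DeJong1996Projective : Prop :=
  ∀ (k : Type u) [Field k] (X : Scheme.{u}) (f : X ⟶ Spec (.of k)),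
    IsSeparated f → LocallyOfFiniteType f → QuasiCompact f → IsIntegral X →
      ∃ (X₁ Xbar₁ : Scheme.{u}) (φ₁ : X₁ ⟶ X) (j₁ : X₁ ⟶ Xbar₁) (g : Xbar₁ ⟶ Spec (.of k)),
        IsAlteration φ₁ ∧ IsOpenImmersion j₁ ∧ IsIntegral Xbar₁ ∧
          Literature.AlgebraicGeometry.Motives.IsProjectiveOver (Over.mk g) ∧ Scheme.IsRegular Xbar₁ ∧ j₁ ≫ g = φ₁ ≫ f

/-- The projective form of Thm. 4.1 implies the weak vendored form `DeJong1996`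
(take the alteration `φ₁`; `X₁` is regular as an open subscheme of the regular `X̄₁`).
[cite: DeJong1996, Thm. 4.1] -/
theorem DeJong1996Projective.deJong1996 (h : DeJong1996Projective.{u}) : DeJong1996.{u} := by
  intro k _ X f hs hl hq hi
  obtain ⟨X₁, Xbar₁, φ₁, j₁, g, hφ, hj, -, -, hreg, -⟩ := h k X f hs hl hq hi
  exact ⟨X₁, φ₁, hφ, hreg.of_isOpenImmersion j₁⟩

/-! ## The base case `dim X = 0` of the induction (de Jong 1996, 4.3) -/

/-- An integral scheme of topological Krull dimension `≤ 0` has only its generic point.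
[folklore] -/
theorem eq_genericPoint_of_topologicalKrullDim_le_zero {X : Scheme.{u}} [IsIntegral X]
    (hdim : topologicalKrullDim X ≤ 0) (x : X) : x = genericPoint X := by
  by_contra hx
  have hlt : (⟨closure {x}, isIrreducible_singleton.closure, isClosed_closure⟩ :
      IrreducibleCloseds X) <
      ⟨Set.univ, IrreducibleSpace.isIrreducible_univ X, isClosed_univ⟩ := by
    refine lt_of_le_of_ne (fun _ _ => trivial) fun heq => hx ?_
    have hgen : IsGenericPoint x Set.univ := congrArg IrreducibleCloseds.carrier heq
    exact hgen.eq (genericPoint_spec X)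
  have h1 : (1 : WithBot ℕ∞) ≤ topologicalKrullDim X :=
    Order.one_le_krullDim_iff.mpr ⟨_, _, hlt⟩
  exact absurd (h1.trans hdim) (by decide)

/-- An integral scheme of topological Krull dimension `≤ 0` is regular: its only local ring is the
function field. [folklore] -/
theorem Scheme.IsRegular.of_topologicalKrullDim_le_zero {X : Scheme.{u}} [IsIntegral X]
    (hdim : topologicalKrullDim X ≤ 0) : Scheme.IsRegular X := by
  intro x
  obtain rfl := eq_genericPoint_of_topologicalKrullDim_le_zero hdim x
  show IsRegularLocalRing X.functionField
  infer_instance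

/-- **Base case of de Jong's induction** (de Jong 1996, 4.3: "The case `dim X = 0` is all
right"): an integral scheme of dimension `0` is regular, so the identity is an alteration with
regular source. [cite: DeJong1996, 4.3] -/
theorem deJong1996_of_topologicalKrullDim_le_zero (X : Scheme.{u}) [IsIntegral X]
    (hdim : topologicalKrullDim X ≤ 0) :
    ∃ (X₁ : Scheme.{u}) (φ : X₁ ⟶ X), IsAlteration φ ∧ Scheme.IsRegular X₁ :=
  ⟨X, 𝟙 X, (isPurelyInseparableAlteration_id X).isAlteration,
    Scheme.IsRegular.of_topologicalKrullDim_le_zero hdim⟩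

/-! ## The reduction step 4.4 -/

/-- **de Jong's reduction step** (de Jong 1996, 4.4 "Strategy of proof": "if `φ : X' → X` is an
alteration [...] If we can prove the theorem for the pair `(X', Z')`, then the theorem will
follow for the pair `(X, Z)`"), for the weak form: a regular alteration of an alteration of `X`
is a regular alteration of `X`, by composition of alterations (2.20). [cite: DeJong1996, 4.4] -/
theorem deJong1996_of_isAlteration {X' X : Scheme.{u}} [IsIntegral X] {φ : X' ⟶ X}
    (hφ : IsAlteration φ)
    (h' : ∃ (X₁ : Scheme.{u}) (ψ : X₁ ⟶ X'), IsAlteration ψ ∧ Scheme.IsRegular X₁) :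
    ∃ (X₁ : Scheme.{u}) (ψ : X₁ ⟶ X), IsAlteration ψ ∧ Scheme.IsRegular X₁ := by
  obtain ⟨X₁, ψ, hψ, hreg⟩ := h'
  exact ⟨X₁, ψ ≫ φ, hψ.comp hφ, hreg⟩

end Literature.AlgebraicGeometry.Resolution

end
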